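import Summits.BirchSwinnertonDyer.Rank1Residual.X11b.TamagawaQuadraticBaseChange
import Summits.BirchSwinnertonDyer.Rank1Residual.X11b.AnticyclotomicLinks
import HarnessLib

/-!
# X11b, routes R1 and p2 — the link (TAM-q) on tree objects: `∏_{w ∣ N⁺} c_w(E/K)` defined, and
# `ord_p ∏_{w ∣ N⁺} c_w(E/K) = ord_p ∏_w c_w(E/K)` PROVED on every erratum field

HONEST FRAMING (cell `b2b-bsdres`, run/shared/lean/b2b/bsd-rank1-residual/, verbatim in every
file): the goal of the cell is to DELETE the COMBINATION-SHAPED residual classes of the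
Birch–Swinnerton-Dyer formula for ALL analytic-rank `≤ 1` elliptic curves over `ℚ` — "full BSD
formula for every rank `≤ 1` curve in class `C`" assembled STRICTLY from published theorems — so
that the rank-`≤ 1` remainder becomes exactly the CONSTRUCTION-SHAPED classes, which are TYPED
(missing-input `Prop`s), NOT attempted. This is not "finishing BSD". Sub-cell
`b2b-bsdres-multr1-p1` (X11b, route R1); a RESEARCH ROUTE; no claim beyond the stated class; X11b
stays CONSTRUCTION-SHAPED; nothing here changes a label; no named fact (two definitions with bodies
and theorems; no `sorry`).

## What this file retires

In `CastellaErratumLinks.lean` (gen 1) the fourth `Λ`-adic link behind Castella's display (5.3) is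
the predicate `LambdaAdicShadow.TamagawaAtRamifiedAt p : S.tamSplitOrd = ord_p ∏_w c_w(E/K)` on a
shadow field `tamSplitOrd` described as "`ord_p ∏_{w ∣ N⁺} c_w(E/K)`, `N⁺` the product of the primes
of `N` split in `K`" (the Tamagawa term of Cas18 Thm. 2.3, `Σ = ∅`) — Castella, Camb. J. Math. 6
(2018) §5 (arXiv:1704.06608 p. 12): "Since `E[p]` is ramified at `q`, we have `ord_p(c_w(E/K)) = 0`
for every prime `w ∣ q` (see e.g. [zhang-Kolyvagin]) … (5.2) can be rewritten as (5.3)". Here: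

* `IsPlaceOverSplitConductorPrime W K w` — the place `w` of `K` lies over a prime `ℓ ∣ N_E` that
  splits in `K` ("`w ∣ N⁺`"); `tamagawaProductSplit W K = ∏_{w ∣ N⁺} c_w(E/K)` (a `finprod` over the
  places of `K`, the factor `c_w(E_K)` of the tree's `tamagawaProduct` at those `w`, `1` elsewhere) —
  the Tamagawa term of Cas18 Thm. 2.3 ON TREE OBJECTS;
* **`padicValNat_tamagawaProductSplit_eq`** — for `W/ℚ` globally minimal elliptic, `p ≥ 5`, `K`
  quadratic such that every prime `ℓ ∣ N_E` non-split in `K` is multiplicative with `E[p]` ramified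
  (`p ∤ ord_ℓ Δ_min`): `ord_p ∏_{w ∣ N⁺} c_w(E/K) = ord_p ∏_w c_w(E/K)`. Proof: both are finite sums
  over the places of `K`; at a place over a split `ℓ ∣ N` the terms agree; a place over `ℓ ∤ N` has
  `c_w` a `p`-unit (the fibre sum is `ord_p c_ℓ(E) + ord_p c_ℓ(E^{(d_K)}) = 2·ord_p c_ℓ(E) = 0`,
  `c_ℓ(E) = 1` at good `ℓ` — gen 2's `padicValNat_sum_fibre_eq`); a place over a non-split `ℓ ∣ N`
  (the ramified `q`) has `c_w` a `p`-unit by the same fibre identity and `p ∤ c_q(E) = ord_q Δ_min`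
  or `∈ {1,…,4}` (Kodaira–Néron, `padicValNat_localTamagawaNumber_eq_zero`);
* `padicValNat_tamagawaProductSplit_eq_of_isErratumField` — the hypothesis holds on every erratum
  field for a non-split multiplicative `q` with `E[p]` ramified (the only non-split bad prime is `q`);
* **`LambdaAdicShadow.tamagawaAtRamifiedAt_of_eq_tamagawaProductSplit`** — a shadow whose field
  `tamSplitOrd` IS `ord_p (tamagawaProductSplit W K)` satisfies the gen-1 link (TAM-q): the link is
  now a THEOREM about a defined quantity, no longer a typed shape; with `AnticyclotomicLinks.lean`
  three of the four numbers entering (CTL) at a datum are on tree objects (`ord_p f_ac(0)` on the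
  constructed `X_ac`, `Ш(E/K)[p^∞]`, `[E(K):ℤP]`, `∏_{w∣N⁺} c_w`); only `ord_p L_p(f)(𝟙)` and
  `ord_p log_ω P` remain shadow fields.

References: [Castella2018] Thm. 2.3 (arXiv:1704.06608 p. 5), §5 (5.2)–(5.3) (p. 12);
[JetchevSkinnerWan2017] §7.3.1 (eq:tamK); [SilvermanAEC2009] Thm. VII.6.1 (Kodaira–Néron).
-/

noncomputable section

open scoped Classical

open WeierstrassCurve NumberField IsDedekindDomain Literature.NumberTheory.EllipticCurves
  Literature.NumberTheory.EllipticCurves.Rank1Residual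

namespace Summit.BirchSwinnertonDyer.Rank1Residual.X11b

section Defs

variable (W : WeierstrassCurve ℚ) (K : Type) [Field K] [NumberField K]

/-- **"`w ∣ N⁺`"**: the finite place `w` of `K` lies over a rational prime `ℓ` dividing the conductor
`N_E` that SPLITS in `K` (`N⁺` = "the product of the prime factors of `N` which are split in `K`",
Cas18 §2.2). [cite: Castella2018, §2.2 (arXiv:1704.06608 p. 5), definition of N⁺] -/
def IsPlaceOverSplitConductorPrime (w : HeightOneSpectrum (𝓞 K)) : Prop :=
  SplitsIn K (Rat.HeightOneSpectrum.primesEquiv (w.under (𝓞 ℚ)) : ℕ) ∧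
    ((Rat.HeightOneSpectrum.primesEquiv (w.under (𝓞 ℚ)) : ℕ) : ℕ) ∣ W.conductorNorm ℤ

/-- **`∏_{w ∣ N⁺} c_w(E/K)`** — the product of the local Tamagawa numbers of `E_K = W.baseChange K`
over the places `w` of `K` above the primes of `N_E` split in `K` (the Tamagawa term of Cas18 Thm. 2.3
with `Σ = ∅`; each factor is the factor of the tree's `(W.baseChange K).tamagawaProduct` at `w`). A
`finprod` (finitely many factors differ from `1`). [cite: Castella2018, Thm. 2.3 (arXiv:1704.06608 p. 5)] -/
def tamagawaProductSplit : ℕ :=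
  ∏ᶠ w : HeightOneSpectrum (𝓞 K),
    if IsPlaceOverSplitConductorPrime W K w then
      ((W.baseChange K).baseChange (w.adicCompletion K)).localTamagawaNumber (w.adicCompletionIntegers K)
    else 1

end Defs

section Valuation

/-- `ord_p` of a finite product of non-zero naturals is the sum of the `ord_p`. [folklore] -/
private theorem padicValNat_finsetProd' {ι : Type*} (p : ℕ) [Fact p.Prime] (s : Finset ι)
    (f : ι → ℕ) (hf : ∀ i ∈ s, f i ≠ 0) :
    padicValNat p (∏ i ∈ s, f i) = ∑ i ∈ s, padicValNat p (f i) := by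
  classical
  induction s using Finset.induction_on with
  | empty => simp
  | insert a s ha ih =>
    rw [Finset.prod_insert ha, Finset.sum_insert ha,
      padicValNat.mul (hf a (Finset.mem_insert_self a s))
        (Finset.prod_ne_zero_iff.mpr fun i hi => hf i (Finset.mem_insert_of_mem hi)),
      ih fun i hi => hf i (Finset.mem_insert_of_mem hi)]

variable (W : WeierstrassCurve ℚ) [W.IsElliptic] [W.IsGloballyMinimal] (p : ℕ) [Fact p.Prime]
  (K : Type) [Field K] [NumberField K]

/-- **(TAM-q) on tree objects: `ord_p ∏_{w ∣ N⁺} c_w(E/K) = ord_p ∏_w c_w(E/K)`** for `W/ℚ` globally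
minimal elliptic, `p ≥ 5`, `K` quadratic (`[K:ℚ] = 2`) such that every prime `ℓ ∣ N_E` that does not
split in `K` is multiplicative with `p ∤ ord_ℓ(Δ_min)` (`hbad`; on an erratum field: `ℓ = q` with
`E[p]` ramified). The places of `K` off `N⁺` contribute `p`-units: over `ℓ ∤ N_E` and over a
non-split bad `ℓ` the fibre sum `Σ_{w∣ℓ} ord_p c_w(E_K) = ord_p c_ℓ(E) + ord_p c_ℓ(E^{(d_K)}) =
2·ord_p c_ℓ(E)` (`padicValNat_sum_fibre_eq`) vanishes (`c_ℓ(E) = 1` at good `ℓ`; Kodaira–Néron at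
the multiplicative `ℓ` with `p ∤ ord_ℓ Δ_min`, `padicValNat_localTamagawaNumber_eq_zero`). Castella
§5: "Since `E[p]` is ramified at `q`, we have `ord_p(c_w(E/K)) = 0` for every prime `w ∣ q`".
[cite: Castella2018, §5 (arXiv:1704.06608 p. 12), from (5.2) to (5.3)]
[cite: JetchevSkinnerWan2017, §7.3.1 (eq:tamK)] -/
theorem padicValNat_tamagawaProductSplit_eq (hp : 5 ≤ p) (h2 : Module.finrank ℚ K = 2)
    (hbad : ∀ (ℓ : ℕ) [Fact ℓ.Prime], ℓ ∣ W.conductorNorm ℤ → ¬ SplitsIn K ℓ →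
      Mult W ℓ ∧ ¬ p ∣ padicValInt ℓ W.minimalDiscriminantInt) :
    padicValNat p (tamagawaProductSplit W K) = padicValNat p (W.baseChange K).tamagawaProduct := by
  have hpr : p.Prime := Fact.out
  haveI hEK : (W.baseChange K).IsElliptic := by rw [baseChange]; infer_instance
  have hd : (NumberField.discr K : ℚ) ≠ 0 := by exact_mod_cast NumberField.discr_ne_zero K
  haveI := W.isElliptic_quadraticTwist hd
  -- the local Tamagawa functions over `K` and over `ℚ`
  set cK : HeightOneSpectrum (𝓞 K) → ℕ := fun w =>
    ((W.baseChange K).baseChange (w.adicCompletion K)).localTamagawaNumber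
      (w.adicCompletionIntegers K) with hcK
  set cQ : HeightOneSpectrum (𝓞 ℚ) → ℕ := fun v =>
    (W.baseChange (v.adicCompletion ℚ)).localTamagawaNumber (v.adicCompletionIntegers ℚ) with hcQ
  set g : HeightOneSpectrum (𝓞 K) → ℕ := fun w =>
    if IsPlaceOverSplitConductorPrime W K w then cK w else 1 with hg
  have hcK0 : ∀ w, cK w ≠ 0 := fun w => (W.baseChange K).localTamagawaNumber_baseChange_ne_zero w
  have hg0 : ∀ w, g w ≠ 0 := fun w => by
    by_cases h : IsPlaceOverSplitConductorPrime W K w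
    · rw [hg]; simp only [h, if_true]; exact hcK0 w
    · rw [hg]; simp only [h, if_false]; exact one_ne_zero
  have hfinK : (Function.mulSupport cK).Finite :=
    (W.baseChange K).mulSupport_localTamagawaNumber_finite_holds
  set SK : Finset (HeightOneSpectrum (𝓞 K)) := hfinK.toFinset with hSK
  have hsubK : Function.mulSupport cK ⊆ ↑SK := by
    intro w hw
    exact hfinK.mem_toFinset.mpr hw
  have hsubg : Function.mulSupport g ⊆ ↑SK := by
    intro w hw
    apply hsubK
    rw [Function.mem_mulSupport] at hw ⊢
    by_cases h : IsPlaceOverSplitConductorPrime W K w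
    · rw [hg] at hw; simp only [h, if_true] at hw; exact hw
    · rw [hg] at hw; simp only [h, if_false] at hw; exact (hw rfl).elim
  -- both valuations as sums over `SK`
  have hK' : padicValNat p (W.baseChange K).tamagawaProduct = ∑ w ∈ SK, padicValNat p (cK w) := by
    rw [show (W.baseChange K).tamagawaProduct = ∏ᶠ w, cK w from rfl,
      finprod_eq_prod_of_mulSupport_subset cK hsubK]
    exact padicValNat_finsetProd' p SK cK fun w _ => hcK0 w
  have hg' : padicValNat p (tamagawaProductSplit W K) = ∑ w ∈ SK, padicValNat p (g w) := by
    rw [show tamagawaProductSplit W K = ∏ᶠ w, g w from rfl,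
      finprod_eq_prod_of_mulSupport_subset g hsubg]
    exact padicValNat_finsetProd' p SK g fun w _ => hg0 w
  rw [hK', hg']
  refine Finset.sum_congr rfl fun w _ => ?_
  by_cases hcond : IsPlaceOverSplitConductorPrime W K w
  · rw [hg]; simp only [hcond, if_true]
  -- off `N⁺`: the factor `c_w(E_K)` is a `p`-unit
  rw [hg]; simp only [hcond, if_false, padicValNat_one_right]
  symm
  set v : HeightOneSpectrum (𝓞 ℚ) := w.under (𝓞 ℚ) with hvdef
  set ℓ : ℕ := (Rat.HeightOneSpectrum.primesEquiv v : ℕ) with hℓdef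
  haveI hℓ : Fact ℓ.Prime := ⟨(Rat.HeightOneSpectrum.primesEquiv v).2⟩
  have hvℓ : (Rat.HeightOneSpectrum.primesEquiv v : ℕ) = ℓ := rfl
  -- the fibre identity of gen 2 over `v`
  have hfib := padicValNat_sum_fibre_eq W p hp K h2 hbad (W.quadraticTwist (NumberField.discr K : ℚ))
    (C := (1 : VariableChange ℚ)) (one_smul _ _) v
  -- `ord_p c_ℓ(E) = 0`
  have hQ0 : padicValNat p (cQ v) = 0 := by
    by_cases hℓN : ℓ ∣ W.conductorNorm ℤ
    · -- `ℓ ∣ N` and `w ∉ N⁺`, so `ℓ` does not split: multiplicative with `p ∤ ord_ℓ Δ_min`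
      have hns : ¬ SplitsIn K ℓ := fun hs => hcond ⟨hs, hℓN⟩
      obtain ⟨hmℓ, hvℓN⟩ := hbad ℓ hℓN hns
      have hmv : W.HasMultiplicativeReductionAt v :=
        (hasMultiplicativeReductionAtPrime_primesEquiv_iff_holds W v ℓ hvℓ).mp hmℓ
      refine padicValNat_localTamagawaNumber_eq_zero W v hp fun n hn hval => ?_
      rw [valuation_j_eq_exp_ordMinimalDiscriminant v W hmv, WithZero.exp_inj] at hval
      have hn' : n = W.ordMinimalDiscriminant v := by exact_mod_cast hval.symm
      rw [hn', ordMinimalDiscriminant_eq_padicValInt W v hvℓ]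
      exact hvℓN
    · -- `ℓ ∤ N`: good reduction, `c_ℓ(E) = 1`
      have hgood : W.HasGoodReductionAt v :=
        (hasGoodReductionAtPrime_primesEquiv_iff_holds W v ℓ hvℓ).mp
          (by
            by_contra hbad'
            exact hℓN ((W.dvd_conductorNorm_iff_not_hasGoodReductionAtPrime ℓ).mpr hbad'))
      have h1 : cQ v = 1 := W.localTamagawaNumber_eq_one_of_hasGoodReductionAt_holds v hgood
      rw [h1, padicValNat_one_right]
  -- hence the fibre sum over `v` vanishes, and so does each of its terms, in particular at `w`
  have hsum0 : (∑ w' ∈ (HeightOneSpectrum.finite_setOf_under_eq_of_numberField (K := K) v).toFinset,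
      padicValNat p (cK w')) = 0 := by
    rw [hfib.1, hfib.2, hQ0]
  have hwmem : w ∈ (HeightOneSpectrum.finite_setOf_under_eq_of_numberField (K := K) v).toFinset := by
    rw [Set.Finite.mem_toFinset]
    exact hvdef.symm
  exact Finset.sum_eq_zero_iff.mp hsum0 w hwmem

/-- **(TAM-q) on every erratum field**: for `p ≥ 5`, a multiplicative `q` with `E[p]` ramified
(`p ∤ ord_q Δ_min`) and an erratum field `K` for `q` (every prime of `N_E` other than `q` splits),
`ord_p ∏_{w ∣ N⁺} c_w(E/K) = ord_p ∏_w c_w(E/K)` — the only non-split bad prime is `q`.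
Castella §5, "(5.2) can be rewritten as (5.3)", with NO semistability.
[cite: Castella2018, §5 (arXiv:1704.06608 p. 12), from (5.2) to (5.3)]
[cite: Castella2018Erratum, "the same argument as in [Cas18, §5]" (p. 1)] -/
theorem padicValNat_tamagawaProductSplit_eq_of_isErratumField (hp : 5 ≤ p) (q : ℕ) [Fact q.Prime]
    (hmq : Mult W q) (hvq : ¬ p ∣ padicValInt q W.minimalDiscriminantInt)
    (hK : IsErratumField W K q) :
    padicValNat p (tamagawaProductSplit W K) = padicValNat p (W.baseChange K).tamagawaProduct := by
  refine padicValNat_tamagawaProductSplit_eq W p K hp hK.1.1 fun ℓ _ hℓN hns => ?_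
  have hℓq : ℓ = q := by
    by_contra hne
    exact hns (hK.2.2.1 ℓ Fact.out hℓN hne)
  subst hℓq
  exact ⟨hmq, hvq⟩

end Valuation

section Shadow

variable {W : WeierstrassCurve ℚ} {K : Type} [Field K] [NumberField K]
  {P : (W.baseChange K).toAffine.Point} (p : ℕ) [Fact p.Prime]

/-- **The gen-1 link (TAM-q) is a THEOREM for a shadow whose Tamagawa field is the defined
`ord_p ∏_{w ∣ N⁺} c_w(E/K)`**: on an erratum field (`p ≥ 5`, `q` multiplicative with `E[p]` ramified),
`S.tamSplitOrd = ord_p (tamagawaProductSplit W K)` gives `S.TamagawaAtRamifiedAt p`. So a consumer of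
`display53At_of_realLinks` / `indexLowerBoundAt_of_realLinks` who instantiates the shadow with THIS
number owes only (BDP) and the `log_ω` term as typed shapes on the analytic side.
[cite: Castella2018, §5 (arXiv:1704.06608 p. 12), from (5.2) to (5.3)] -/
theorem LambdaAdicShadow.tamagawaAtRamifiedAt_of_eq_tamagawaProductSplit [W.IsElliptic]
    [W.IsGloballyMinimal] (S : LambdaAdicShadow W K P) {hp : 5 ≤ p} {q : ℕ} [Fact q.Prime]
    (hmq : Mult W q) (hvq : ¬ p ∣ padicValInt q W.minimalDiscriminantInt) (hK : IsErratumField W K q)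
    (hS : S.tamSplitOrd = padicValNat p (tamagawaProductSplit W K)) :
    S.TamagawaAtRamifiedAt p := by
  unfold LambdaAdicShadow.TamagawaAtRamifiedAt
  rw [hS, padicValNat_tamagawaProductSplit_eq_of_isErratumField W p K hp q hmq hvq hK]

/-- **Castella's display (5.3) from the real links with (TAM-q) DISCHARGED**: on an erratum field,
for a shadow carrying the defined `N⁺`-Tamagawa valuation, (IMC@𝟙)ʳ [OPEN] ∘ (BDP) ∘ (CTL)ʳ [PUB
shapes] ⟹ `Display53At W p K P`. CONDITIONAL on (IMC@𝟙)ʳ.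
[cite: Castella2018, §5 (5.1)–(5.3) (arXiv:1704.06608 p. 12)] [cite: Castella2018Erratum, Thm. 1.1 (p. 1)] -/
theorem display53At_of_realLinks_of_isErratumField [W.IsElliptic] [W.IsGloballyMinimal]
    (κ : ZpExtension K p) (𝔭 : HeightOneSpectrum (𝓞 K)) (γ : Field.absoluteGaloisGroup K)
    [Fact (κ.IsTopGenerator γ)] (S : LambdaAdicShadow W K P) {hp : 5 ≤ p} {q : ℕ} [Fact q.Prime]
    (hmq : Mult W q) (hvq : ¬ p ∣ padicValInt q W.minimalDiscriminantInt) (hK : IsErratumField W K q)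
    (hS : S.tamSplitOrd = padicValNat p (tamagawaProductSplit W K))
    (hIMC : S.IMCAtTrivialCharReal p κ 𝔭 γ) (hBDP : S.WaldspurgerAt) (hCTL : S.ControlAtReal p κ 𝔭 γ) :
    Display53At W p K P :=
  display53At_of_realLinks S hIMC hBDP hCTL
    (S.tamagawaAtRamifiedAt_of_eq_tamagawaProductSplit p (hp := hp) hmq hvq hK hS)

end Shadow

end Summit.BirchSwinnertonDyer.Rank1Residual.X11b

end
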